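import Summits.QuantumFields.YangMills.Theorems.BalabanUVNodesN13Cor3LastRegionCountAtRecord13CoPH
import Summits.QuantumFields.YangMills.Theorems.BalabanUVNodesN13UVChiOffSolvableAtRecord13
import Literature.MathematicalPhysics.QuantumFieldTheory.Balaban1983to89.Node00.Record13SepCoPH

/-!
# BalabanUVNodes ∕ N13 — THE COMBINATORIAL LEAF OF [III] COR. 3 AT NODE 00's STAGE-13 RECORD, II: THE FULL-HISTORY COUNT, (0.1) ONE RUN ∕ ONE STEP, AND K1⁷'s (B) CONJUNCT
# `EndStatementBPrinted` AT ITS LITERAL DATUM FROM THEOREM 1 + (U1_Z) + (L2) — THE LEAVES (H), (U2), (L1) GONE (Track A, DAG node N13 = [B16]; cluster K1 — K1⁷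
# `StabilityBAtRecordR13SepCoPH` = stmt-QuantumFields-20542, helper; seat `pub-ymgap-dag-n13-w3` g2; companion of `…N13Cor3LastRegionCountAtRecord13CoPH`; 2026-08-28; count-neutral)

HONEST FRAMING.  Count-neutral kernel BOOKKEEPING + [folklore] finite combinatorics; nothing of Bałaban's is asserted.  The sibling file proved the p. 264 sentence's COMBINATORIAL half in the
(0.2) [IV] last-region currency; this file (a) proves it ALSO in the full-history currency of g0's p592785 — over the admissible `(Ω, Λ)`-sequences of (2.1) [III], `Σ_s Π_{j≤k} x_j^{#𝐃_j-cubes ⊄ Ω_j}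
y_j^{#𝐃_j-cubes ⊄ Λ_j} ≤ exp Σ_j (x_j + y_j)|I_j|` (the chains inject into `Π_j 𝒫(I_j)²` by `S ↦ {cubes inside S}`; `Finset.prod_univ_sum`) — so p592785's binder `hU2` is DISCHARGED for product
majorants, with the LOCATED numeric demand stated in numbers: `|I_j| = ⌈2L^{m+K}∕(L^j M R_j)⌉⁴ ≈ L^{4(k−j)}·|T₁^{(k)}|∕(M R_j)⁴`, i.e. early-step factors must satisfy `x_j + y_j ≲ L^{−4(k−j)}`
([IV] p. 175: *«the small factor arising from large fields in this region does not control further steps»*) — which is WHY the (0.2) currency is the one to use; (b) assembles the run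
family at K1⁷'s record in the (0.2) currency: `Cor3With` ∕ `Cor3_250` ∕ ★★★ `EndStatementBPrinted ((datumOfRecord₁₃SepCoPH θ h).C)` from Theorem 1 at the record (N11 ∕ N13's 𝐑-row product, a
HYPOTHESIS) + (U1_Z) «`ρ_k(Z, V) ≤ e^{a0(g_k)|T₁^{(k)}|}·xf(g_k)^{#𝐃_k-cubes meeting Z}`» ([IV] (1.1) ∕ [V] (1.89)-type, NOT proved) + (L2) (content only on the small locus, dag-n13-w1 g2 p597573 ∕
p597863), with `a0 + xf ≤ e₊` pointwise («E₊ depending on g_k»); (L1) is DISCHARGED at every `Provisos₁₃CoPH` parameter by dag-n13-w1's `histTerm_nonneg` (ζ-laws; cf. p594664).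
N13 NOT discharged; K0⁷ ∕ K1⁷ NOT closed; counts unmoved (discharged 5∕27 · Track A 5∕28).  ONE finite four-torus programme at fixed `ε = L^{−K}`; R4 closes the conditional finite-𝕋⁴ rung
`BalabanLadder.UV` only — the Yang–Mills mass gap (Clay) is NOT proved by any of this; nothing continuum ∕ ℝ⁴ ∕ OS.  No `sorry`, `def`, `instance`, `notation`.

WHAT THIS FILE PROVES.
§1 [folklore]: `seq_eq_of_inside_eq` (two (2.1)-chains with the same cubes inside their domains coincide), ★ `sum_seq_prod_pow_lf_le_prod` ∕ `sum_seq_prod_pow_lf_le_exp` (the history count).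
§2 at the record: ★★ `uvIneq_at_record₁₃CoPH_of_pieceBound_of_L2` ((0.1) one run ∕ one step, both halves: (U1_Z) + numeric clause + (L2); (L1) discharged); `sum_historyMajorant₁₃_le_exp`,
   `densOfRecord₁₃_le_of_historyBound` (the full-history currency: p592785's `hU2` for product majorants `e^a Π_j x_j^{#⊄Ω_j} y_j^{#⊄Λ_j}`).
§3 the run family (Z-currency): ★★★ `cor3With_datumOfRecord₁₃CoPH_of_pieceBounds`, `cor3_250_datumOfRecord₁₃CoPH_of_thm1_of_pieceBounds`, `endStatementBPrinted_datumOfRecord₁₃CoPH_of_thm1_of_pieceBounds`.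
§4 K1⁷'s literal datum: ★★★ `endStatementBPrinted_datumOfRecord₁₃SepCoPH_of_thm1_of_pieceBounds` (def-T's `rfl` bridge at `h.toCore`).

Sources: [Balaban1988Convergent] (2.1)–(2.3) p.254–255, (2.18) p.257, Thm 1 p.262, Cor. 3 (2.50) p.264; [Balaban1989LargeFieldI] p.175, (0.2) p.176; [Balaban1982Higgs2] (3.42) p.592,
(3.46) p.593 (cite only); [Balaban1989LargeFieldII] Thm 1 p.355, (0.1) pp.355–356.
-/

noncomputable section

open MeasureTheory
open scoped BigOperators

namespace Summit.QuantumFields.YangMills.BalabanUVNodes.N13Cor3HistoryCountAtRecord13CoPH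

open Literature.MathematicalPhysics.QuantumFieldTheory.Balaban1983to89
open T4Continuum Node00 B14.Eq218Concrete
open Literature.Computability.AlgebraicComplexity.SlidingWindow (one_add_pow_le_exp)
open B16NodeKnitRecord13CoPH (uvIneq_at_record₁₃CoPH_iff)
open Summit.QuantumFields.YangMills.BalabanUVNodes.N13Cor3Repr218LeavesAtRecord13CoPH
  (densOfRecord₁₃_le_of_U1_U2 le_densOfRecord₁₃_of_L1_L2 sLaw₁₃CoPH_of_thm1)
open Summit.QuantumFields.YangMills.BalabanUVNodes.N13Cor3LastRegionCountAtRecord13CoPH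
open B14Cor3 (inInterval_of_le)
open Summit.QuantumFields.YangMills.BalabanUVNodes.N13UVChiOffSolvableAtRecord13 (histTerm_nonneg)

/-! ## §1. Finite combinatorics [folklore]: the count over FULL HISTORIES — (2.1)-chains inject into `Π_j 𝒫(I_j)²` -/

section Histories

variable {ι α : Type*}

/-- Two admissible `(Ω, Λ)`-sequences over classes of unions of cubes whose domains contain THE SAME CUBES at every step of the window coincide (`injOn_inside` stepwise + the
normalisation off the window). [folklore] -/
theorem seq_eq_of_inside_eq (D : ℕ → Set (Set α)) (k : ℕ) (I : ℕ → Finset ι) (cube : ℕ → ι → Set α)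
    (hD : ∀ j, 1 ≤ j → j ≤ k → ∀ S ∈ D j, ∃ A : Finset ι, A ⊆ I j ∧ S = ⋃ a ∈ A, cube j a) {s t : Seq D k}
    (h : ∀ j, 1 ≤ j → j ≤ k →
      {c | c ∈ I j ∧ cube j c ⊆ s.Ω j} = {c | c ∈ I j ∧ cube j c ⊆ t.Ω j} ∧ {c | c ∈ I j ∧ cube j c ⊆ s.Λ j} = {c | c ∈ I j ∧ cube j c ⊆ t.Λ j}) :
    s = t := by
  have hwin : ∀ j, 1 ≤ j → j ≤ k → s.Ω j = t.Ω j ∧ s.Λ j = t.Λ j := fun j h1j hjk =>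
    ⟨injOn_inside (I j) (cube j) (D j) (hD j h1j hjk) (s.chain.memΩ j h1j hjk) (t.chain.memΩ j h1j hjk) (h j h1j hjk).1,
      injOn_inside (I j) (cube j) (D j) (hD j h1j hjk) (s.chain.memΛ j h1j hjk) (t.chain.memΛ j h1j hjk) (h j h1j hjk).2⟩
  apply Seq.ext'
  · funext j
    by_cases hj : 1 ≤ j ∧ j ≤ k
    · exact (hwin j hj.1 hj.2).1
    · rw [s.Ω_off j hj, t.Ω_off j hj]
  · funext j
    by_cases hj : 1 ≤ j ∧ j ≤ k
    · exact (hwin j hj.1 hj.2).2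
    · rw [s.Λ_off j hj, t.Λ_off j hj]

/-- **★ THE HISTORY COUNT** (product form): over the admissible `(Ω, Λ)`-sequences of (2.1) [III] of length `k` whose classes `𝐃_j` (`1 ≤ j ≤ k`) consist of unions of cubes of
finite families `I_j`, and for per-step factors `x_j, y_j ≥ 0`,
`Σ_s Π_{j=1}^{k} x_j^{#I_j-cubes ⊄ Ω_j(s)} · y_j^{#I_j-cubes ⊄ Λ_j(s)} ≤ Π_{j=1}^{k} (1 + x_j)^{|I_j|} (1 + y_j)^{|I_j|}` — the chains inject into `Π_j 𝒫(I_j) × 𝒫(I_j)` by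
`S ↦ {cubes inside S}` (`seq_eq_of_inside_eq`) and the product of binomial sums is `Finset.prod_univ_sum`. [folklore] -/
theorem sum_seq_prod_pow_lf_le_prod [Finite α] (D : ℕ → Set (Set α)) (k : ℕ) (I : ℕ → Finset ι) (cube : ℕ → ι → Set α)
    (hD : ∀ j, 1 ≤ j → j ≤ k → ∀ S ∈ D j, ∃ A : Finset ι, A ⊆ I j ∧ S = ⋃ a ∈ A, cube j a)
    {x y : ℕ → ℝ} (hx : ∀ j, 0 ≤ x j) (hy : ∀ j, 0 ≤ y j) :
    ∑ s : Seq D k, ∏ j ∈ Finset.Icc 1 k,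
        (x j ^ Set.ncard {c | c ∈ I j ∧ ¬ cube j c ⊆ s.Ω j} * y j ^ Set.ncard {c | c ∈ I j ∧ ¬ cube j c ⊆ s.Λ j})
      ≤ ∏ j ∈ Finset.Icc 1 k, ((1 + x j) ^ (I j).card * (1 + y j) ^ (I j).card) := by
  classical
  -- local names (with defining equations) for the encoding `E`, the weight `W` and the target boxes `T`
  obtain ⟨E, hE⟩ : ∃ E : Seq D k → (↥(Finset.Icc 1 k) → Finset ι × Finset ι),
      E = fun (s : Seq D k) (j : ↥(Finset.Icc 1 k)) =>
        ((I j.1).filter (fun c => cube j.1 c ⊆ s.Ω j.1), (I j.1).filter (fun c => cube j.1 c ⊆ s.Λ j.1)) := ⟨_, rfl⟩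
  obtain ⟨W, hW⟩ : ∃ W : (↥(Finset.Icc 1 k) → Finset ι × Finset ι) → ℝ,
      W = fun (w : ↥(Finset.Icc 1 k) → Finset ι × Finset ι) =>
        ∏ j : ↥(Finset.Icc 1 k), (x j.1 ^ ((I j.1).card - (w j).1.card) * y j.1 ^ ((I j.1).card - (w j).2.card)) :=
    ⟨_, rfl⟩
  obtain ⟨T, hT⟩ : ∃ T : ↥(Finset.Icc 1 k) → Finset (Finset ι × Finset ι),
      T = fun (j : ↥(Finset.Icc 1 k)) => (I j.1).powerset ×ˢ (I j.1).powerset := ⟨_, rfl⟩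
  -- (1) the summand is `W (E s)`
  have h1 : ∀ s : Seq D k, (∏ j ∈ Finset.Icc 1 k,
      (x j ^ Set.ncard {c | c ∈ I j ∧ ¬ cube j c ⊆ s.Ω j} * y j ^ Set.ncard {c | c ∈ I j ∧ ¬ cube j c ⊆ s.Λ j})) = W (E s) := by
    intro s
    rw [hW, hE]
    dsimp only
    calc (∏ j ∈ Finset.Icc 1 k,
          (x j ^ Set.ncard {c | c ∈ I j ∧ ¬ cube j c ⊆ s.Ω j} * y j ^ Set.ncard {c | c ∈ I j ∧ ¬ cube j c ⊆ s.Λ j}))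
        = ∏ j : ↥(Finset.Icc 1 k),
            (x j.1 ^ Set.ncard {c | c ∈ I j.1 ∧ ¬ cube j.1 c ⊆ s.Ω j.1} * y j.1 ^ Set.ncard {c | c ∈ I j.1 ∧ ¬ cube j.1 c ⊆ s.Λ j.1}) :=
          (Finset.prod_coe_sort (Finset.Icc 1 k) (fun j =>
            x j ^ Set.ncard {c | c ∈ I j ∧ ¬ cube j c ⊆ s.Ω j} * y j ^ Set.ncard {c | c ∈ I j ∧ ¬ cube j c ⊆ s.Λ j})).symm
      _ = _ := Finset.prod_congr rfl fun j _ => by rw [ncard_not_subset_eq, ncard_not_subset_eq]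
  -- (2) the encoding is injective
  have h2 : Function.Injective E := by
    intro s t hst
    refine seq_eq_of_inside_eq D k I cube hD fun j h1j hjk => ?_
    have hj : j ∈ Finset.Icc 1 k := Finset.mem_Icc.mpr ⟨h1j, hjk⟩
    have hc := congrFun hst ⟨j, hj⟩
    rw [hE] at hc
    simp only [Prod.mk.injEq] at hc
    refine ⟨?_, ?_⟩
    · have := congrArg (fun B : Finset ι => (B : Set ι)) hc.1
      simpa only [Finset.coe_filter] using this
    · have := congrArg (fun B : Finset ι => (B : Set ι)) hc.2
      simpa only [Finset.coe_filter] using this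
  -- (3) the encoding lands in `Π_j 𝒫(I_j) × 𝒫(I_j)`
  have h3 : Finset.univ.image E ⊆ Fintype.piFinset T := by
    intro w hw
    rw [Finset.mem_image] at hw
    obtain ⟨s, -, rfl⟩ := hw
    rw [Fintype.mem_piFinset]
    intro j
    rw [hE, hT]
    simp only [Finset.mem_product, Finset.mem_powerset]
    exact ⟨Finset.filter_subset _ _, Finset.filter_subset _ _⟩
  -- (4) the weights are non-negative
  have h4 : ∀ w, 0 ≤ W w := by
    intro w
    rw [hW]
    exact Finset.prod_nonneg fun j _ => mul_nonneg (pow_nonneg (hx _) _) (pow_nonneg (hy _) _)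
  -- (5) the box sums are binomial
  have h5 : ∀ j : ↥(Finset.Icc 1 k), ∑ p ∈ T j, (x j.1 ^ ((I j.1).card - p.1.card) * y j.1 ^ ((I j.1).card - p.2.card))
      = (1 + x j.1) ^ (I j.1).card * (1 + y j.1) ^ (I j.1).card := by
    intro j
    rw [hT]
    dsimp only
    rw [Finset.sum_product, ← sum_powerset_pow_card_sub (I j.1) (x j.1), ← sum_powerset_pow_card_sub (I j.1) (y j.1),
      Finset.sum_mul_sum]
  -- (6) the sum over the boxes is the product of the box sums
  have h6 : ∑ w ∈ Fintype.piFinset T, W w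
      = ∏ j : ↥(Finset.Icc 1 k), ∑ p ∈ T j, (x j.1 ^ ((I j.1).card - p.1.card) * y j.1 ^ ((I j.1).card - p.2.card)) := by
    rw [hW]
    exact (Finset.prod_univ_sum T (fun j p => x j.1 ^ ((I j.1).card - p.1.card) * y j.1 ^ ((I j.1).card - p.2.card))).symm
  calc ∑ s : Seq D k, ∏ j ∈ Finset.Icc 1 k,
          (x j ^ Set.ncard {c | c ∈ I j ∧ ¬ cube j c ⊆ s.Ω j} * y j ^ Set.ncard {c | c ∈ I j ∧ ¬ cube j c ⊆ s.Λ j})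
      = ∑ s : Seq D k, W (E s) := Finset.sum_congr rfl fun s _ => h1 s
    _ = ∑ w ∈ Finset.univ.image E, W w := (Finset.sum_image fun s _ t _ h => h2 h).symm
    _ ≤ ∑ w ∈ Fintype.piFinset T, W w := Finset.sum_le_sum_of_subset_of_nonneg h3 fun w _ _ => h4 w
    _ = ∏ j : ↥(Finset.Icc 1 k), ∑ p ∈ T j, (x j.1 ^ ((I j.1).card - p.1.card) * y j.1 ^ ((I j.1).card - p.2.card)) := h6
    _ = ∏ j : ↥(Finset.Icc 1 k), ((1 + x j.1) ^ (I j.1).card * (1 + y j.1) ^ (I j.1).card) :=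
        Finset.prod_congr rfl fun j _ => h5 j
    _ = ∏ j ∈ Finset.Icc 1 k, ((1 + x j) ^ (I j).card * (1 + y j) ^ (I j).card) :=
        Finset.prod_coe_sort (Finset.Icc 1 k) (fun j => (1 + x j) ^ (I j).card * (1 + y j) ^ (I j).card)

/-- **★ THE HISTORY COUNT, exponential form**: `Σ_s Π_{j=1}^{k} x_j^{#⊄Ω_j} y_j^{#⊄Λ_j} ≤ exp(Σ_{j=1}^{k} (x_j + y_j)·|I_j|)`. [folklore] -/
theorem sum_seq_prod_pow_lf_le_exp [Finite α] (D : ℕ → Set (Set α)) (k : ℕ) (I : ℕ → Finset ι) (cube : ℕ → ι → Set α)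
    (hD : ∀ j, 1 ≤ j → j ≤ k → ∀ S ∈ D j, ∃ A : Finset ι, A ⊆ I j ∧ S = ⋃ a ∈ A, cube j a)
    {x y : ℕ → ℝ} (hx : ∀ j, 0 ≤ x j) (hy : ∀ j, 0 ≤ y j) :
    ∑ s : Seq D k, ∏ j ∈ Finset.Icc 1 k,
        (x j ^ Set.ncard {c | c ∈ I j ∧ ¬ cube j c ⊆ s.Ω j} * y j ^ Set.ncard {c | c ∈ I j ∧ ¬ cube j c ⊆ s.Λ j})
      ≤ Real.exp (∑ j ∈ Finset.Icc 1 k, (x j + y j) * (I j).card) := by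
  refine (sum_seq_prod_pow_lf_le_prod D k I cube hD hx hy).trans ?_
  rw [Real.exp_sum]
  have h0 : ∀ j, (0 : ℝ) ≤ (1 + x j) ^ (I j).card * (1 + y j) ^ (I j).card := fun j =>
    mul_nonneg (pow_nonneg (by linarith [hx j]) _) (pow_nonneg (by linarith [hy j]) _)
  refine Finset.prod_le_prod (fun j _ => h0 j) fun j _ => ?_
  rw [add_mul, Real.exp_add]
  exact mul_le_mul (one_add_pow_le_exp (hx j) _) (one_add_pow_le_exp (hy j) _)
    (pow_nonneg (by linarith [hy j]) _) (Real.exp_pos _).le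

end Histories

/-! ## §2. AT THE RECORD: (0.1) one run ∕ one step in the (0.2) currency; the full-history currency (p592785's `hU2` for product majorants) -/

section AtRecord

variable (F : T4Family) (N : ℕ) [NeZero N]
variable (θ : Stage13HParams F N) (P : B12.RunParams) (k : ℕ)

open Classical in
/-- **★★ (0.1) AT THE RECORD, ONE RUN ∕ ONE STEP, BOTH HALVES, WITH THE COMBINATORIAL LEAF PROVED** (Co datum): from (U1_Z) + the numeric clause (upper half, `densOfRecord₁₃_le_of_pieceBound`) and
(L2) at the record's histories (lower half, g0's `le_densOfRecord₁₃_of_L1_L2` with (L1) DISCHARGED at every `Provisos₁₃CoPH` parameter by dag-n13-w1's `histTerm_nonneg` — the ζ-laws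
`h.zetaUnity` ∕ `h.zetaAbs`; cf. p594664) conclude `B16.UVIneq ((datumOfRecord₁₃CoPH F N θ h).C P) k V E₋ E₊` at every configuration (module 36's `uvIneq_at_record₁₃CoPH_iff`).  CONDITIONAL on
(U1_Z), (L2); nothing of Bałaban's asserted. [cite: Balaban1988Convergent, Cor. 3 (2.50) p.264; Balaban1989LargeFieldII, (0.1) pp.355–356] -/
theorem uvIneq_at_record₁₃CoPH_of_pieceBound_of_L2 (h : θ.Provisos₁₃CoPH F N) {x : ℝ} (hx : 0 ≤ x) (a Em Ep : ℝ)
    (hU1Z : ∀ Z : Set (Site (F.P P.K) 0), Zᶜ ∈ DOfRecord F θ.ν θ.τ9.M (gOfRecord₁₃ F N θ.toStage13Params P) P.K k →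
      ∀ V : GaugeField (F.P P.K) k (SU N), pieceOfRecord F N θ.ν θ.τ9.M
        (slotsOfRecord F N θ.ν θ.τ9 (EOfRecord₁₃ F N θ.toStage13Params) (wOfRecord₉ F N θ.toStage9Params) θ.ppSel)
        P (gOfRecord₁₃ F N θ.toStage13Params P) k Z V ≤
        Real.exp a * x ^ Set.ncard {c | c ∈ cubeIndices (F.P P.K) (dCubeSide (F.P P.K).L θ.τ9.M
            (RkOfRecord (F.P P.K).L θ.ν.r (gOfRecord₁₃ F N θ.toStage13Params P k)) k) ∧
          ¬ cubeEnl (F.P P.K) (dCubeSide (F.P P.K).L θ.τ9.M (RkOfRecord (F.P P.K).L θ.ν.r (gOfRecord₁₃ F N θ.toStage13Params P k)) k) c 0 ⊆ Zᶜ})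
    (hnum : a + x * (cubeIndices (F.P P.K) (dCubeSide (F.P P.K).L θ.τ9.M
        (RkOfRecord (F.P P.K).L θ.ν.r (gOfRecord₁₃ F N θ.toStage13Params P k)) k)).card ≤ Ep * (Fintype.card (Site (F.P P.K) k) : ℝ))
    (s₀ : (reprOfRecord₁₃ F N θ.toStage13Params P k).Adm)
    (hL2 : ∀ V, chiβOfRecord₁₃ F N θ.toStage13Params P.K (gOfRecord₁₃ F N θ.toStage13Params P) k V *
        Real.exp (-(1 / (gOfRecord₁₃ F N θ.toStage13Params P k) ^ 2 * wilsonBGOfRecord F N θ.εbg P k V) - Em * (Fintype.card (Site (F.P P.K) k) : ℝ)) ≤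
      (reprOfRecord₁₃ F N θ.toStage13Params P k).χ s₀ V * (reprOfRecord₁₃ F N θ.toStage13Params P k).TexpA s₀ V) :
    ∀ V : GaugeField (F.P P.K) k (SU N), B16.UVIneq ((datumOfRecord₁₃CoPH F N θ h).C P) k V Em Ep :=
  fun V => (uvIneq_at_record₁₃CoPH_iff F N θ h P k V Em Ep).2
    ⟨le_densOfRecord₁₃_of_L1_L2 F N θ P k s₀ Em (fun s U => histTerm_nonneg θ.toStage13Params h.zetaUnity h.zetaAbs P k s U) hL2 V,
      densOfRecord₁₃_le_of_pieceBound F N θ P k hx a Ep hU1Z hnum V⟩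

open Classical in
/-- **THE FULL-HISTORY CURRENCY: g0's (U2) DISCHARGED FOR PRODUCT MAJORANTS** (`…N13Cor3Repr218LeavesAtRecord13CoPH.densOfRecord₁₃_le_of_U1_U2`'s binder `hU2`, for majorants of the form
`major s = e^a · Π_{j=1}^{k} x_j^{#𝐃_j-cubes ⊄ Ω_j(s)} · y_j^{#𝐃_j-cubes ⊄ Λ_j(s)}` on the record's histories): `Σ_s major s ≤ exp(a + Σ_{j=1}^{k} (x_j + y_j)·|I_j|)` (`sum_seq_prod_pow_lf_le_exp` at
`𝐃 := DOfRecord`).  LOCATED NUMERIC DEMAND (numbers, not adjectives): `|I_j| = ⌈2L^{m+K}∕(L^j M R_j)⌉⁴ ≈ L^{4(k−j)}·|T₁^{(k)}|∕(M R_j)⁴`, so meeting `… ≤ E₊|T₁^{(k)}|` `K`-uniformly forces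
`x_j + y_j ≲ L^{−4(k−j)}` at the early steps — the d = 4 sentence of [IV] p.175 («the small factor arising from large fields in this region does not control further steps») in numbers; the
(0.2) currency above asks only step `k`'s count `x·|I_k| ≤ x·|T₁^{(k)}|`. [cite: Balaban1988Convergent, p.264; Balaban1989LargeFieldI, p.175 and (0.2) p.176 (bookkeeping)] -/
theorem sum_historyMajorant₁₃_le_exp {x y : ℕ → ℝ} (hx : ∀ j, 0 ≤ x j) (hy : ∀ j, 0 ≤ y j) (a : ℝ) :
    ∑ s : SeqOfRecord F θ.ν θ.τ9.M (gOfRecord₁₃ F N θ.toStage13Params P) P.K k,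
        Real.exp a * ∏ j ∈ Finset.Icc 1 k,
          (x j ^ Set.ncard {c | c ∈ cubeIndices (F.P P.K) (dCubeSide (F.P P.K).L θ.τ9.M
              (RkOfRecord (F.P P.K).L θ.ν.r (gOfRecord₁₃ F N θ.toStage13Params P j)) j) ∧
            ¬ cubeEnl (F.P P.K) (dCubeSide (F.P P.K).L θ.τ9.M (RkOfRecord (F.P P.K).L θ.ν.r (gOfRecord₁₃ F N θ.toStage13Params P j)) j) c 0 ⊆ s.Ω j} *
           y j ^ Set.ncard {c | c ∈ cubeIndices (F.P P.K) (dCubeSide (F.P P.K).L θ.τ9.M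
              (RkOfRecord (F.P P.K).L θ.ν.r (gOfRecord₁₃ F N θ.toStage13Params P j)) j) ∧
            ¬ cubeEnl (F.P P.K) (dCubeSide (F.P P.K).L θ.τ9.M (RkOfRecord (F.P P.K).L θ.ν.r (gOfRecord₁₃ F N θ.toStage13Params P j)) j) c 0 ⊆ s.Λ j})
      ≤ Real.exp (a + ∑ j ∈ Finset.Icc 1 k, (x j + y j) *
          (cubeIndices (F.P P.K) (dCubeSide (F.P P.K).L θ.τ9.M (RkOfRecord (F.P P.K).L θ.ν.r (gOfRecord₁₃ F N θ.toStage13Params P j)) j)).card) := by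
  rw [← Finset.mul_sum, Real.exp_add]
  refine mul_le_mul_of_nonneg_left ?_ (Real.exp_pos a).le
  exact sum_seq_prod_pow_lf_le_exp (DOfRecord F θ.ν θ.τ9.M (gOfRecord₁₃ F N θ.toStage13Params P) P.K) k
    (fun j => cubeIndices (F.P P.K) (dCubeSide (F.P P.K).L θ.τ9.M (RkOfRecord (F.P P.K).L θ.ν.r (gOfRecord₁₃ F N θ.toStage13Params P j)) j))
    (fun j c => cubeEnl (F.P P.K) (dCubeSide (F.P P.K).L θ.τ9.M (RkOfRecord (F.P P.K).L θ.ν.r (gOfRecord₁₃ F N θ.toStage13Params P j)) j) c 0)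
    (fun j _ _ S hS => (mem_unionsOfCubes_iff _ _ S).1 hS) hx hy

open Classical in
/-- **UPPER HALF OF (0.1) AT THE RECORD IN THE FULL-HISTORY CURRENCY** (g0's `densOfRecord₁₃_le_of_U1_U2` with (U2) PROVED): from the per-history product bound (U1π)
`χ_k(s)(V)·slot_k(s)(V) ≤ e^a · Π_{j=1}^{k} x_j^{#⊄Ω_j(s)} y_j^{#⊄Λ_j(s)}` and the numeric clause `a + Σ_j (x_j + y_j)|I_j| ≤ E₊|T₁^{(k)}|`, `ρ_k(V) ≤ exp(E₊|T₁^{(k)}|)`.  See the located demand in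
`sum_historyMajorant₁₃_le_exp`.  CONDITIONAL on (U1π); nothing of Bałaban's asserted. [cite: Balaban1988Convergent, Cor. 3 (2.50) p.264 (bookkeeping)] -/
theorem densOfRecord₁₃_le_of_historyBound {x y : ℕ → ℝ} (hx : ∀ j, 0 ≤ x j) (hy : ∀ j, 0 ≤ y j) (a Ep : ℝ)
    (hU1π : ∀ (s : SeqOfRecord F θ.ν θ.τ9.M (gOfRecord₁₃ F N θ.toStage13Params P) P.K k) (V : GaugeField (F.P P.K) k (SU N)),
      (reprOfRecord₁₃ F N θ.toStage13Params P k).χ s V * (reprOfRecord₁₃ F N θ.toStage13Params P k).TexpA s V ≤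
        Real.exp a * ∏ j ∈ Finset.Icc 1 k,
          (x j ^ Set.ncard {c | c ∈ cubeIndices (F.P P.K) (dCubeSide (F.P P.K).L θ.τ9.M
              (RkOfRecord (F.P P.K).L θ.ν.r (gOfRecord₁₃ F N θ.toStage13Params P j)) j) ∧
            ¬ cubeEnl (F.P P.K) (dCubeSide (F.P P.K).L θ.τ9.M (RkOfRecord (F.P P.K).L θ.ν.r (gOfRecord₁₃ F N θ.toStage13Params P j)) j) c 0 ⊆ s.Ω j} *
           y j ^ Set.ncard {c | c ∈ cubeIndices (F.P P.K) (dCubeSide (F.P P.K).L θ.τ9.M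
              (RkOfRecord (F.P P.K).L θ.ν.r (gOfRecord₁₃ F N θ.toStage13Params P j)) j) ∧
            ¬ cubeEnl (F.P P.K) (dCubeSide (F.P P.K).L θ.τ9.M (RkOfRecord (F.P P.K).L θ.ν.r (gOfRecord₁₃ F N θ.toStage13Params P j)) j) c 0 ⊆ s.Λ j}))
    (hnum : a + ∑ j ∈ Finset.Icc 1 k, (x j + y j) *
          (cubeIndices (F.P P.K) (dCubeSide (F.P P.K).L θ.τ9.M (RkOfRecord (F.P P.K).L θ.ν.r (gOfRecord₁₃ F N θ.toStage13Params P j)) j)).card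
        ≤ Ep * (Fintype.card (Site (F.P P.K) k) : ℝ)) :
    ∀ V : GaugeField (F.P P.K) k (SU N), densOfRecord₁₃ F N θ.toStage13Params P k V ≤ Real.exp (Ep * (Fintype.card (Site (F.P P.K) k) : ℝ)) :=
  densOfRecord₁₃_le_of_U1_U2 F N θ P k
    (fun (s : SeqOfRecord F θ.ν θ.τ9.M (gOfRecord₁₃ F N θ.toStage13Params P) P.K k) => Real.exp a * ∏ j ∈ Finset.Icc 1 k,
          (x j ^ Set.ncard {c | c ∈ cubeIndices (F.P P.K) (dCubeSide (F.P P.K).L θ.τ9.M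
              (RkOfRecord (F.P P.K).L θ.ν.r (gOfRecord₁₃ F N θ.toStage13Params P j)) j) ∧
            ¬ cubeEnl (F.P P.K) (dCubeSide (F.P P.K).L θ.τ9.M (RkOfRecord (F.P P.K).L θ.ν.r (gOfRecord₁₃ F N θ.toStage13Params P j)) j) c 0 ⊆ s.Ω j} *
           y j ^ Set.ncard {c | c ∈ cubeIndices (F.P P.K) (dCubeSide (F.P P.K).L θ.τ9.M
              (RkOfRecord (F.P P.K).L θ.ν.r (gOfRecord₁₃ F N θ.toStage13Params P j)) j) ∧
            ¬ cubeEnl (F.P P.K) (dCubeSide (F.P P.K).L θ.τ9.M (RkOfRecord (F.P P.K).L θ.ν.r (gOfRecord₁₃ F N θ.toStage13Params P j)) j) c 0 ⊆ s.Λ j}))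
    Ep hU1π ((sum_historyMajorant₁₃_le_exp F N θ P k hx hy a).trans (Real.exp_le_exp.mpr hnum))
end AtRecord

/-! ## §3. THE RUN FAMILY at K1⁷'s record: `Cor3With`, `Cor3_250`, `EndStatementBPrinted` from Theorem 1 + (U1_Z) + (L2) — the leaves (H), (U2), (L1) are GONE -/

section Family

variable (F : T4Family) (N : ℕ) [NeZero N]
variable (θ : Stage13HParams F N) (h : θ.Provisos₁₃CoPH F N)

open Classical in
/-- **★★★ [III] COR. 3 «WITH e±» AT THE RECORD FROM THEOREM 1's CONCLUSION + (U1_Z) + (L2)** (the Z-currency twin of g0's `cor3With_datumOfRecord₁₃CoPH_of_repr218Leaves`, with the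
combinatorial leaf (U2) PROVED, (H) and (L1) discharged): per-step data are two functions of the running coupling — the small factor `xf(g_k) ≥ 0` per large-field `𝐃_k`-cube of the last region and
the volume rate `a0(g_k)` — with `a0 + xf ≤ ep` pointwise («E₊ depending on g_k», p.264); the leaves are guarded by the interval hypothesis and Theorem 1's conclusion `SLaw₁₃CoPH θ P k` as adv3
guards them.  CONDITIONAL on (U1_Z), (L2) and `hS` ((L1) discharged by dag-n13-w1's `histTerm_nonneg` at `h`); nothing of Bałaban's asserted. [cite: Balaban1988Convergent, Thm 1 p.262, Cor. 3 (2.50) p.264; Balaban1989LargeFieldI, (0.2) p.176] -/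
theorem cor3With_datumOfRecord₁₃CoPH_of_pieceBounds (γ : ℝ) (em ep xf a0 : ℝ → ℝ) (hx : ∀ g, 0 ≤ xf g) (hep : ∀ g, a0 g + xf g ≤ ep g)
    (s₀ : (P : B12.RunParams) → (k : ℕ) → (reprOfRecord₁₃ F N θ.toStage13Params P k).Adm)
    (hS : ∀ P : B12.RunParams, ((datumOfRecord₁₃CoPH F N θ h).C P).flow.InInterval γ P.K → ∀ k, k ≤ P.K → SLaw₁₃CoPH F N θ P k)
    (hU1Z : ∀ P : B12.RunParams, ((datumOfRecord₁₃CoPH F N θ h).C P).flow.InInterval γ P.K → ∀ k, k ≤ P.K → SLaw₁₃CoPH F N θ P k →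
      ∀ Z : Set (Site (F.P P.K) 0), Zᶜ ∈ DOfRecord F θ.ν θ.τ9.M (gOfRecord₁₃ F N θ.toStage13Params P) P.K k →
      ∀ V : GaugeField (F.P P.K) k (SU N), pieceOfRecord F N θ.ν θ.τ9.M
        (slotsOfRecord F N θ.ν θ.τ9 (EOfRecord₁₃ F N θ.toStage13Params) (wOfRecord₉ F N θ.toStage9Params) θ.ppSel)
        P (gOfRecord₁₃ F N θ.toStage13Params P) k Z V ≤
        Real.exp (a0 (gOfRecord₁₃ F N θ.toStage13Params P k) * (Fintype.card (Site (F.P P.K) k) : ℝ)) *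
          xf (gOfRecord₁₃ F N θ.toStage13Params P k) ^ Set.ncard {c | c ∈ cubeIndices (F.P P.K) (dCubeSide (F.P P.K).L θ.τ9.M
            (RkOfRecord (F.P P.K).L θ.ν.r (gOfRecord₁₃ F N θ.toStage13Params P k)) k) ∧
          ¬ cubeEnl (F.P P.K) (dCubeSide (F.P P.K).L θ.τ9.M (RkOfRecord (F.P P.K).L θ.ν.r (gOfRecord₁₃ F N θ.toStage13Params P k)) k) c 0 ⊆ Zᶜ})
    (hL2 : ∀ P : B12.RunParams, ((datumOfRecord₁₃CoPH F N θ h).C P).flow.InInterval γ P.K → ∀ k, k ≤ P.K → SLaw₁₃CoPH F N θ P k →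
      ∀ V, chiβOfRecord₁₃ F N θ.toStage13Params P.K (gOfRecord₁₃ F N θ.toStage13Params P) k V *
          Real.exp (-(1 / (gOfRecord₁₃ F N θ.toStage13Params P k) ^ 2 * wilsonBGOfRecord F N θ.εbg P k V)
            - em (gOfRecord₁₃ F N θ.toStage13Params P k) * (Fintype.card (Site (F.P P.K) k) : ℝ)) ≤
        (reprOfRecord₁₃ F N θ.toStage13Params P k).χ (s₀ P k) V * (reprOfRecord₁₃ F N θ.toStage13Params P k).TexpA (s₀ P k) V) :
    B16.Cor3With (datumOfRecord₁₃CoPH F N θ h).C γ em ep := by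
  intro P hP k hk V
  have hs : SLaw₁₃CoPH F N θ P k := hS P hP k hk
  exact (uvIneq_at_record₁₃CoPH_iff F N θ h P k V _ _).2
    ⟨le_densOfRecord₁₃_of_L1_L2 F N θ P k (s₀ P k) _ (fun s U => histTerm_nonneg θ.toStage13Params h.zetaUnity h.zetaAbs P k s U)
        (hL2 P hP k hk hs) V,
      densOfRecord₁₃_le_of_pieceBound_siteUnits F N θ P k hk (hx _) (a0 _) (ep _) (hep _) (hU1Z P hP k hk hs) V⟩

open Classical in
/-- **★★★ [III] COR. 3 (`B16.Cor3_250`) AT THE RECORD FROM THEOREM 1 AT THE RECORD + (U1_Z) + (L2) ON `]0, γ]`** (the `min γ γ₁` logic of adv3's `cor3_250_of_leaves`; (U2) PROVED, (H) ∕ (L1)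
discharged).  CONDITIONAL; nothing of Bałaban's asserted. [cite: Balaban1988Convergent, Cor. 3 (2.50) p.264; Balaban1989LargeFieldII, Thm 1 p.355] -/
theorem cor3_250_datumOfRecord₁₃CoPH_of_thm1_of_pieceBounds (γ : ℝ) (hγ : 0 < γ) (em ep xf a0 : ℝ → ℝ) (hx : ∀ g, 0 ≤ xf g) (hep : ∀ g, a0 g + xf g ≤ ep g)
    (s₀ : (P : B12.RunParams) → (k : ℕ) → (reprOfRecord₁₃ F N θ.toStage13Params P k).Adm)
    (h1 : B16.Thm1Printed (datumOfRecord₁₃CoPH F N θ h).C)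
    (hU1Z : ∀ P : B12.RunParams, ((datumOfRecord₁₃CoPH F N θ h).C P).flow.InInterval γ P.K → ∀ k, k ≤ P.K → SLaw₁₃CoPH F N θ P k →
      ∀ Z : Set (Site (F.P P.K) 0), Zᶜ ∈ DOfRecord F θ.ν θ.τ9.M (gOfRecord₁₃ F N θ.toStage13Params P) P.K k →
      ∀ V : GaugeField (F.P P.K) k (SU N), pieceOfRecord F N θ.ν θ.τ9.M
        (slotsOfRecord F N θ.ν θ.τ9 (EOfRecord₁₃ F N θ.toStage13Params) (wOfRecord₉ F N θ.toStage9Params) θ.ppSel)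
        P (gOfRecord₁₃ F N θ.toStage13Params P) k Z V ≤
        Real.exp (a0 (gOfRecord₁₃ F N θ.toStage13Params P k) * (Fintype.card (Site (F.P P.K) k) : ℝ)) *
          xf (gOfRecord₁₃ F N θ.toStage13Params P k) ^ Set.ncard {c | c ∈ cubeIndices (F.P P.K) (dCubeSide (F.P P.K).L θ.τ9.M
            (RkOfRecord (F.P P.K).L θ.ν.r (gOfRecord₁₃ F N θ.toStage13Params P k)) k) ∧
          ¬ cubeEnl (F.P P.K) (dCubeSide (F.P P.K).L θ.τ9.M (RkOfRecord (F.P P.K).L θ.ν.r (gOfRecord₁₃ F N θ.toStage13Params P k)) k) c 0 ⊆ Zᶜ})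
    (hL2 : ∀ P : B12.RunParams, ((datumOfRecord₁₃CoPH F N θ h).C P).flow.InInterval γ P.K → ∀ k, k ≤ P.K → SLaw₁₃CoPH F N θ P k →
      ∀ V, chiβOfRecord₁₃ F N θ.toStage13Params P.K (gOfRecord₁₃ F N θ.toStage13Params P) k V *
          Real.exp (-(1 / (gOfRecord₁₃ F N θ.toStage13Params P k) ^ 2 * wilsonBGOfRecord F N θ.εbg P k V)
            - em (gOfRecord₁₃ F N θ.toStage13Params P k) * (Fintype.card (Site (F.P P.K) k) : ℝ)) ≤
        (reprOfRecord₁₃ F N θ.toStage13Params P k).χ (s₀ P k) V * (reprOfRecord₁₃ F N θ.toStage13Params P k).TexpA (s₀ P k) V) :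
    B16.Cor3_250 (datumOfRecord₁₃CoPH F N θ h).C := by
  obtain ⟨γ₁, hγ₁, H1⟩ := sLaw₁₃CoPH_of_thm1 F N θ h h1
  refine ⟨min γ γ₁, lt_min hγ hγ₁, em, ep, ?_⟩
  refine cor3With_datumOfRecord₁₃CoPH_of_pieceBounds F N θ h (min γ γ₁) em ep xf a0 hx hep s₀ ?_ ?_ ?_
  · exact fun P hP k hk => H1 P (inInterval_of_le hP (min_le_right γ γ₁)) k hk
  · exact fun P hP => hU1Z P (inInterval_of_le hP (min_le_left γ γ₁))
  · exact fun P hP => hL2 P (inInterval_of_le hP (min_le_left γ γ₁))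

open Classical in
/-- **★★★ K1⁷'s (B) CONJUNCT AT ITS OWN RECORD = THEOREM 1 AT THE RECORD + TWO DISPLAYED ESTIMATES (U1_Z) ∕ (L2)** — `B16.EndStatementBPrinted ((datumOfRecord₁₃CoPH θ h).C)` = Theorem 1 ∧
[III] Cor. 3, with the p. 264 sentence's COMBINATORIAL half («the combinatorics now is the same …, hence we have the same result», [6] (3.42)) a THEOREM in the (0.2) currency and its analytic
half displayed as ONE estimate per last region: (U1_Z) «`ρ_k(Z, V) ≤ e^{a0(g_k)|T₁^{(k)}|} · xf(g_k)^{#𝐃_k-cubes meeting Z}`» ([IV] (1.1) ∕ [V] (1.89)-type, NOT proved), `a0 + xf ≤ e₊`; (L1) is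
DISCHARGED here (dag-n13-w1's `histTerm_nonneg` at `h`; cf. p594664); (L2) has content only on the small locus (dag-n13-w1 g2, p597573 ∕ p597863).  CONDITIONAL; K1⁷ NOT closed; nothing of Bałaban's asserted.
[cite: Balaban1989LargeFieldII, Thm 1 p.355, (0.1) pp.355–356; Balaban1988Convergent, Cor. 3 p.264; Balaban1989LargeFieldI, (0.2) p.176] -/
theorem endStatementBPrinted_datumOfRecord₁₃CoPH_of_thm1_of_pieceBounds (γ : ℝ) (hγ : 0 < γ) (em ep xf a0 : ℝ → ℝ) (hx : ∀ g, 0 ≤ xf g)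
    (hep : ∀ g, a0 g + xf g ≤ ep g) (s₀ : (P : B12.RunParams) → (k : ℕ) → (reprOfRecord₁₃ F N θ.toStage13Params P k).Adm)
    (h1 : B16.Thm1Printed (datumOfRecord₁₃CoPH F N θ h).C)
    (hU1Z : ∀ P : B12.RunParams, ((datumOfRecord₁₃CoPH F N θ h).C P).flow.InInterval γ P.K → ∀ k, k ≤ P.K → SLaw₁₃CoPH F N θ P k →
      ∀ Z : Set (Site (F.P P.K) 0), Zᶜ ∈ DOfRecord F θ.ν θ.τ9.M (gOfRecord₁₃ F N θ.toStage13Params P) P.K k →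
      ∀ V : GaugeField (F.P P.K) k (SU N), pieceOfRecord F N θ.ν θ.τ9.M
        (slotsOfRecord F N θ.ν θ.τ9 (EOfRecord₁₃ F N θ.toStage13Params) (wOfRecord₉ F N θ.toStage9Params) θ.ppSel)
        P (gOfRecord₁₃ F N θ.toStage13Params P) k Z V ≤
        Real.exp (a0 (gOfRecord₁₃ F N θ.toStage13Params P k) * (Fintype.card (Site (F.P P.K) k) : ℝ)) *
          xf (gOfRecord₁₃ F N θ.toStage13Params P k) ^ Set.ncard {c | c ∈ cubeIndices (F.P P.K) (dCubeSide (F.P P.K).L θ.τ9.M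
            (RkOfRecord (F.P P.K).L θ.ν.r (gOfRecord₁₃ F N θ.toStage13Params P k)) k) ∧
          ¬ cubeEnl (F.P P.K) (dCubeSide (F.P P.K).L θ.τ9.M (RkOfRecord (F.P P.K).L θ.ν.r (gOfRecord₁₃ F N θ.toStage13Params P k)) k) c 0 ⊆ Zᶜ})
    (hL2 : ∀ P : B12.RunParams, ((datumOfRecord₁₃CoPH F N θ h).C P).flow.InInterval γ P.K → ∀ k, k ≤ P.K → SLaw₁₃CoPH F N θ P k →
      ∀ V, chiβOfRecord₁₃ F N θ.toStage13Params P.K (gOfRecord₁₃ F N θ.toStage13Params P) k V *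
          Real.exp (-(1 / (gOfRecord₁₃ F N θ.toStage13Params P k) ^ 2 * wilsonBGOfRecord F N θ.εbg P k V)
            - em (gOfRecord₁₃ F N θ.toStage13Params P k) * (Fintype.card (Site (F.P P.K) k) : ℝ)) ≤
        (reprOfRecord₁₃ F N θ.toStage13Params P k).χ (s₀ P k) V * (reprOfRecord₁₃ F N θ.toStage13Params P k).TexpA (s₀ P k) V) :
    B16.EndStatementBPrinted (datumOfRecord₁₃CoPH F N θ h).C :=
  ⟨h1, cor3_250_datumOfRecord₁₃CoPH_of_thm1_of_pieceBounds F N θ h γ hγ em ep xf a0 hx hep s₀ h1 hU1Z hL2⟩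

end Family

/-! ## §4. K1⁷'s OWN DATUM `datumOfRecord₁₃SepCoPH` (def-T's `rfl` bridge `datumOfRecord₁₃SepCoPH_eq_coPH`) -/

section SepCoPH

variable (F : T4Family) (N : ℕ) [NeZero N]
variable (θ : Stage13HParams F N) (h : θ.Provisos₁₃SepCoPH F N)

open Classical in
/-- **★★★ K1⁷'s (B) CONJUNCT AT ITS LITERAL DATUM `datumOfRecord₁₃SepCoPH θ h`** (the one `StabilityBAtRecordR13SepCoPH` names) from Theorem 1 at that datum + (U1_Z) + (L2) on `]0, γ]` —
§4 at `h.toCore` along def-T's `rfl` bridge.  CONDITIONAL; K1⁷ NOT closed (its ∃θ ∕ guard ∕ admissibility ∕ window are elsewhere: K0⁷, n13-w4's window files); nothing of Bałaban's asserted.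
[cite: Balaban1989LargeFieldII, Thm 1 p.355, (0.1) pp.355–356; Balaban1988Convergent, Cor. 3 p.264; Balaban1989LargeFieldI, (0.2) p.176] -/
theorem endStatementBPrinted_datumOfRecord₁₃SepCoPH_of_thm1_of_pieceBounds (γ : ℝ) (hγ : 0 < γ) (em ep xf a0 : ℝ → ℝ) (hx : ∀ g, 0 ≤ xf g)
    (hep : ∀ g, a0 g + xf g ≤ ep g) (s₀ : (P : B12.RunParams) → (k : ℕ) → (reprOfRecord₁₃ F N θ.toStage13Params P k).Adm)
    (h1 : B16.Thm1Printed (datumOfRecord₁₃SepCoPH F N θ h).C)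
    (hU1Z : ∀ P : B12.RunParams, ((datumOfRecord₁₃SepCoPH F N θ h).C P).flow.InInterval γ P.K → ∀ k, k ≤ P.K → SLaw₁₃CoPH F N θ P k →
      ∀ Z : Set (Site (F.P P.K) 0), Zᶜ ∈ DOfRecord F θ.ν θ.τ9.M (gOfRecord₁₃ F N θ.toStage13Params P) P.K k →
      ∀ V : GaugeField (F.P P.K) k (SU N), pieceOfRecord F N θ.ν θ.τ9.M
        (slotsOfRecord F N θ.ν θ.τ9 (EOfRecord₁₃ F N θ.toStage13Params) (wOfRecord₉ F N θ.toStage9Params) θ.ppSel)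
        P (gOfRecord₁₃ F N θ.toStage13Params P) k Z V ≤
        Real.exp (a0 (gOfRecord₁₃ F N θ.toStage13Params P k) * (Fintype.card (Site (F.P P.K) k) : ℝ)) *
          xf (gOfRecord₁₃ F N θ.toStage13Params P k) ^ Set.ncard {c | c ∈ cubeIndices (F.P P.K) (dCubeSide (F.P P.K).L θ.τ9.M
            (RkOfRecord (F.P P.K).L θ.ν.r (gOfRecord₁₃ F N θ.toStage13Params P k)) k) ∧
          ¬ cubeEnl (F.P P.K) (dCubeSide (F.P P.K).L θ.τ9.M (RkOfRecord (F.P P.K).L θ.ν.r (gOfRecord₁₃ F N θ.toStage13Params P k)) k) c 0 ⊆ Zᶜ})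
    (hL2 : ∀ P : B12.RunParams, ((datumOfRecord₁₃SepCoPH F N θ h).C P).flow.InInterval γ P.K → ∀ k, k ≤ P.K → SLaw₁₃CoPH F N θ P k →
      ∀ V, chiβOfRecord₁₃ F N θ.toStage13Params P.K (gOfRecord₁₃ F N θ.toStage13Params P) k V *
          Real.exp (-(1 / (gOfRecord₁₃ F N θ.toStage13Params P k) ^ 2 * wilsonBGOfRecord F N θ.εbg P k V)
            - em (gOfRecord₁₃ F N θ.toStage13Params P k) * (Fintype.card (Site (F.P P.K) k) : ℝ)) ≤
        (reprOfRecord₁₃ F N θ.toStage13Params P k).χ (s₀ P k) V * (reprOfRecord₁₃ F N θ.toStage13Params P k).TexpA (s₀ P k) V) :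
    B16.EndStatementBPrinted (datumOfRecord₁₃SepCoPH F N θ h).C :=
  endStatementBPrinted_datumOfRecord₁₃CoPH_of_thm1_of_pieceBounds F N θ h.toCore γ hγ em ep xf a0 hx hep s₀ h1 hU1Z hL2

end SepCoPH

end Summit.QuantumFields.YangMills.BalabanUVNodes.N13Cor3HistoryCountAtRecord13CoPH

end
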